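import Mathlib
import Literature.AlgebraicGeometry.Resolution.CobordantGame
import Summits.ResolutionOfSingularities.ResolutionOfSingularities.Theorems.WeightedInvariantLocalWeightedDropTwistedCylinder

/-!
# `WeightedInvariant.LocalWeightedDrop`: sanity of the twisted-triviality predicates (vacuity as typed / teeth of the repair)

Route `ResolutionOfSingularities/WeightedInvariant`, crux `LocalWeightedDrop`
(stmt-ResolutionOfSingularities-8899).  [OURS · L1 W4.3] — two kernel facts about the predicates landed in
`…Theorems.GradedGame` (`WeightedInvariantLocalWeightedDropTwistedCylinder`), recorded for the triage of
ideator res-L1-w43-idea-1's card A (res-L1-w43-tri-1 TRIAGE v4 §13).  Nothing here is a statement of the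
manuscript under review on ladder RESOLUTION; AI-produced, weaker than expert review.

* `GradedGame.twistedTrivialAlong_iff` — the sketch's predicate AS TYPED is equivalent to `γ(0) = 0`, for
  every germ `f` and every `p` (witness: `Φ :=` the translation itself, `e := 0`, `u := 1`).  Hence it cannot
  serve as the I-saturation test of card A's rule (every axis direction would be saturated).
* `GradedGame.not_twistedTrivialAlongFix_X_sq` — the ORIGIN-FIXING repair has teeth: `x²` (one variable) is
  NOT twisted-trivial along its own axis.  Proof: kill the `x`-variable (`x ↦ 0`, `σ ↦ σ`); an origin-fixing
  `Φ` dies, so the right-hand side `u·Φ(x)²` dies, while the translated germ `(x + σ^{p^e})²` becomes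
  `σ^{2p^e} ≠ 0`.
Together with `GradedGame.successor_twistedTrivialFix_axis` (wild axis successors ARE twisted-trivial in the
repaired sense) this brackets the repaired predicate from both sides.
-/

set_option linter.dupNamespace false -- mandated namespace of this single-conjunct summit
set_option autoImplicit false

namespace Summit.ResolutionOfSingularities.ResolutionOfSingularities.Theorems

namespace GradedGame

open MvPowerSeries
open Literature.AlgebraicGeometry.Resolution

variable {k : Type} [Field k]

/-! ## As typed: vacuity -/

/-- A series substituted along `X 0` only has no `X_{j+1}`-linear coefficient. [OURS · L1 W4.3] -/
theorem coeff_single_succ_subst_X_zero_pow {n : ℕ} (m : ℕ) (hm : m ≠ 0) (γ : MvPowerSeries (Fin 1) k) (j : Fin n) :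
    coeff (Finsupp.single j.succ 1)
      (subst (fun _ : Fin 1 => (X (0 : Fin (n + 1)) ^ m : MvPowerSeries (Fin (n + 1)) k)) γ) = 0 := by
  classical
  have ha : HasSubst (fun _ : Fin 1 => (X (0 : Fin (n + 1)) ^ m : MvPowerSeries (Fin (n + 1)) k)) :=
    hasSubst_of_constantCoeff_zero fun _ => by simp [constantCoeff_X, zero_pow hm]
  rw [coeff_subst ha]
  apply finsum_eq_zero_of_forall_eq_zero
  intro d
  have hprod : (d.prod fun (s : Fin 1) (e : ℕ) => ((X (0 : Fin (n + 1)) ^ m : MvPowerSeries (Fin (n + 1)) k)) ^ e) =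
      X (0 : Fin (n + 1)) ^ (m * d 0) := by
    rw [Finsupp.prod_fintype _ _ (fun _ => by simp)]
    simp [pow_mul]
  rw [hprod, coeff_X_pow, if_neg, smul_zero]
  intro h
  have h1 := DFunLike.congr_fun h j.succ
  simp at h1

/-- VACUITY WITNESS: as typed, `TwistedTrivialAlong p f γ` holds for every `f` as soon as `γ(0) = 0` — take
`e := 0`, `u := 1` and `Φ :=` the translation itself. [OURS · L1 W4.3] -/
theorem twistedTrivialAlong_of_constantCoeff_zero (p : ℕ) {n : ℕ} (f : MvPowerSeries (Fin n) k)
    (γ : Fin n → MvPowerSeries (Fin 1) k) (hγ : ∀ i, constantCoeff (γ i) = 0) :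
    TwistedTrivialAlong p f γ := by
  classical
  set a : Fin 1 → MvPowerSeries (Fin (n + 1)) k := fun _ => X (0 : Fin (n + 1)) ^ (p ^ 0) with ha_def
  have ha : HasSubst a := hasSubst_of_constantCoeff_zero fun _ => by simp [a, constantCoeff_X]
  refine ⟨hγ, 0, fun i : Fin n => X i.succ + subst a (γ i), 1, isUnit_one, ?_, ?_, ?_⟩
  · intro j
    rw [map_add, constantCoeff_X, zero_add]
    exact constantCoeff_subst_eq_zero ha (fun _ => by simp [a, constantCoeff_X]) (hγ j)
  · have hM : (Matrix.of fun i j : Fin n => coeff (Finsupp.single j.succ 1) (X i.succ + subst a (γ i))) =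
        (1 : Matrix (Fin n) (Fin n) k) := by
      ext i j
      rw [Matrix.of_apply, map_add, ha_def, coeff_single_succ_subst_X_zero_pow (p ^ 0) (by simp) (γ i) j,
        add_zero, coeff_X, Matrix.one_apply]
      by_cases h : i = j
      · subst h; simp
      · rw [if_neg, if_neg h]
        intro h'
        apply h
        have := (Finsupp.single_left_inj (one_ne_zero)).mp h'
        exact (Fin.succ_injective _ this).symm
    rw [hM, Matrix.det_one]
    exact isUnit_one
  · rw [one_mul]

/-- `TwistedTrivialAlong` AS TYPED is equivalent to `γ(0) = 0`, independently of `f` and `p`: the predicate is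
content-free beyond its first conjunct (this is why card A's I-saturation test needs the origin-fixing repair
`TwistedTrivialAlongFix`). [OURS · L1 W4.3] -/
theorem twistedTrivialAlong_iff (p : ℕ) {n : ℕ} (f : MvPowerSeries (Fin n) k) (γ : Fin n → MvPowerSeries (Fin 1) k) :
    TwistedTrivialAlong p f γ ↔ ∀ i, constantCoeff (γ i) = 0 :=
  ⟨fun h => h.1, twistedTrivialAlong_of_constantCoeff_zero p f γ⟩

/-- Every germ is twisted-trivial along every axis, as typed. [OURS · L1 W4.3] -/
theorem twistedTrivialAlong_axisCurve (p : ℕ) {n : ℕ} (f : MvPowerSeries (Fin n) k) (i : Fin n) :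
    TwistedTrivialAlong p f (axisCurve i) :=
  twistedTrivialAlong_of_constantCoeff_zero p f _ fun j => by
    unfold axisCurve
    split_ifs <;> simp [constantCoeff_X]

/-! ## The repair has teeth: `x²` is not twisted-trivial along its own axis -/

/-- `x²` (one variable) is NOT twisted-trivial along the `x`-axis in the origin-fixing sense: killing `x`
sends `u·Φ(x)²` to `0` (origin-fixing) but `(x + σ^{p^e})²` to `σ^{2p^e} ≠ 0` (`p ≠ 0`, so that `σ^{p^e}` is a
genuine translation parameter). [OURS · L1 W4.3] -/
theorem not_twistedTrivialAlongFix_X_sq (p : ℕ) (hp : p ≠ 0) :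
    ¬ TwistedTrivialAlongFix p ((X (0 : Fin 1)) ^ 2 : MvPowerSeries (Fin 1) k) (axisCurve 0) := by
  classical
  rintro ⟨-, e, Φ, u, -, hΦ0, hfix, -, heq⟩
  have hpe : p ^ e ≠ 0 := pow_ne_zero e hp
  -- the killing substitution `K : x ↦ 0, σ ↦ σ` on `k⟦σ, x⟧`
  set K : Fin (1 + 1) → MvPowerSeries (Fin (1 + 1)) k :=
    fun v => if v = 0 then (X (0 : Fin (1 + 1)) : MvPowerSeries (Fin (1 + 1)) k) else 0 with hK
  have hKs : HasSubst K := hasSubst_of_constantCoeff_zero fun v => by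
    by_cases hv : v = 0 <;> simp [hK, hv, constantCoeff_X]
  -- the translation family `T : x ↦ x + σ^{p^e}`
  set T : Fin 1 → MvPowerSeries (Fin (1 + 1)) k :=
    fun i => X i.succ + subst (fun _ : Fin 1 => (X (0 : Fin (1 + 1)) : MvPowerSeries (Fin (1 + 1)) k) ^ (p ^ e))
      (axisCurve (k := k) (0 : Fin 1) i) with hT
  have ha : HasSubst (fun _ : Fin 1 => (X (0 : Fin (1 + 1)) : MvPowerSeries (Fin (1 + 1)) k) ^ (p ^ e)) :=
    hasSubst_of_constantCoeff_zero fun _ => by simp [constantCoeff_X, zero_pow hpe]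
  have hT0 : T 0 = X (Fin.succ 0) + X 0 ^ (p ^ e) := by
    simp only [hT, axisCurve, if_true, subst_X ha]
  have hTs : HasSubst T := hasSubst_of_constantCoeff_zero fun i => by
    rw [Subsingleton.elim i 0, hT0, map_add, constantCoeff_X, map_pow, constantCoeff_X, zero_add]
    exact zero_pow hpe
  have hΦs : HasSubst Φ := hasSubst_of_constantCoeff_zero hΦ0
  -- apply `K` to both sides of the defining equation
  have hL : subst K (subst T ((X (0 : Fin 1)) ^ 2 : MvPowerSeries (Fin 1) k)) = (X 0 ^ (p ^ e)) ^ 2 := by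
    rw [subst_pow hTs, subst_X hTs, hT0, subst_pow hKs, subst_add hKs, subst_pow hKs, subst_X hKs, subst_X hKs]
    simp [hK]
  have hR : subst K (u * subst Φ ((X (0 : Fin 1)) ^ 2 : MvPowerSeries (Fin 1) k)) = 0 := by
    rw [subst_mul hKs, subst_pow hΦs, subst_X hΦs, subst_pow hKs, hfix 0]
    simp
  have := congrArg (subst K) heq
  rw [hL, hR] at this
  exact pow_ne_zero 2 (pow_ne_zero (p ^ e) (nonZeroDivisors.ne_zero X_mem_nonzeroDivisors)) this

end GradedGame

end Summit.ResolutionOfSingularities.ResolutionOfSingularities.Theorems
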